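import Mathlib.Topology.Instances.ENNReal.Lemmas
import Mathlib.Order.ConditionallyCompleteLattice.Basic
import Mathlib.Algebra.Order.Field.Basic
import HarnessLib

/-!
# BECHardSphereReduction / HardCoreDominates — the Dini glue
# (stub `stub_diniGlue` of line `birth`, skeleton v6)

Crux `HardCoreDominates` (stmt-AtomisticToContinuum-11884) of route `BECHardSphereReduction`,
line `birth`. Pure real analysis: a pointwise-finite function `g : ℝ≥0 → ℝ≥0∞` which is lower
semicontinuous (neighbourhood form: every `m < g t₀` stays `< g t` for `|t - t₀| ≤ ρ`) and whose
upper-right Dini derivative is non-positive everywhere (`ε`–`h₀` form: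
`∀ t, ∀ ε > 0, ∃ h₀ > 0, ∀ 0 < h ≤ h₀, g (t + h) ≤ g t + ε h`) is antitone.

## Proof

Pass to `f := ENNReal.toReal ∘ g : ℝ≥0 → ℝ` (`DiniGlue.lsc_toReal`, `DiniGlue.dini_toReal`).
For a fixed slope `ε` the function `F u := f u - ε u` is lower semicontinuous from the left and
locally right-non-increasing, hence antitone by the supremum argument on
`S := {u ∈ [s, t] | F u ≤ F s}` (`DiniGlue.sub_mul_le_sub_mul`): the supremum `c` of `S` lies in `S`
by left lower semicontinuity, and `c < t` would contradict the local right-non-increase at `c`.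
Letting `ε → 0` (`exists_pos_mul_lt`, `le_of_forall_pos_le_add`) gives `f t ≤ f s`
(`DiniGlue.antitone_real`), and `ENNReal.toReal_le_toReal` returns to `ℝ≥0∞`.
-/

noncomputable section

namespace Summit.AtomisticToContinuum.BoseEinsteinCondensation.Cruxes.HardCoreDominates.Birth

open scoped ENNReal NNReal

namespace DiniGlue

/-- **Supremum argument.** If `f : ℝ≥0 → ℝ` is lower semicontinuous (neighbourhood form) and
`u ↦ f u - ε u` is locally right-non-increasing (`f (u + h) ≤ f u + ε h` for `0 < h ≤ h₀(u)`), then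
`u ↦ f u - ε u` is antitone: `f t - ε t ≤ f s - ε s` for `s ≤ t`. The supremum `c` of
`{u ∈ [s, t] | f u - ε u ≤ f s - ε s}` belongs to the set (left lower semicontinuity at `c`), and
`c < t` is impossible (one more right step from `c` stays in the set). [folklore] -/
theorem sub_mul_le_sub_mul {f : ℝ≥0 → ℝ}
    (hlsc : ∀ (t₀ : ℝ≥0) (m : ℝ), m < f t₀ →
      ∃ ρ : ℝ≥0, 0 < ρ ∧ ∀ t : ℝ≥0, t₀ ≤ t + ρ → t ≤ t₀ + ρ → m < f t)
    {ε : ℝ≥0}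
    (hdini : ∀ t : ℝ≥0, ∃ h₀ : ℝ≥0, 0 < h₀ ∧ ∀ h : ℝ≥0, 0 < h → h ≤ h₀ → f (t + h) ≤ f t + ε * h)
    {s t : ℝ≥0} (hst : s ≤ t) :
    f t - ε * t ≤ f s - ε * s := by
  set S : Set ℝ≥0 := {u | s ≤ u ∧ u ≤ t ∧ f u - ε * u ≤ f s - ε * s}
  have hsS : s ∈ S := ⟨le_rfl, hst, le_rfl⟩
  have hne : S.Nonempty := ⟨s, hsS⟩
  have hbdd : BddAbove S := ⟨t, fun u hu => hu.2.1⟩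
  have hsc : s ≤ sSup S := le_csSup hbdd hsS
  have hct : sSup S ≤ t := csSup_le hne fun u hu => hu.2.1
  -- Step 1: the supremum belongs to `S` (left lower semicontinuity).
  have hcS : f (sSup S) - ε * (sSup S : ℝ≥0) ≤ f s - ε * s := by
    refine not_lt.1 fun hlt => ?_
    have hsc' : s < sSup S := by
      rcases hsc.eq_or_lt with h | h
      · rw [← h] at hlt
        exact absurd hlt (lt_irrefl _)
      · exact h
    have hm : f s - ε * s + ε * (sSup S : ℝ≥0) < f (sSup S) := by linarith
    obtain ⟨ρ, hρ, hρ'⟩ := hlsc (sSup S) _ hm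
    have hlt' : sSup S - ρ < sSup S := tsub_lt_self (pos_of_gt hsc') hρ
    obtain ⟨u, huS, hu⟩ := exists_lt_of_lt_csSup hne hlt'
    have huc : u ≤ sSup S := le_csSup hbdd huS
    have h1 : sSup S ≤ u + ρ := le_tsub_add.trans (add_le_add_left hu.le ρ)
    have h2 : u ≤ sSup S + ρ := huc.trans le_self_add
    have hfu := hρ' u h1 h2
    have hεu : (ε : ℝ) * u ≤ ε * (sSup S : ℝ≥0) :=
      mul_le_mul_of_nonneg_left (NNReal.coe_le_coe.2 huc) ε.2
    have hFu : f u - ε * u ≤ f s - ε * s := huS.2.2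
    linarith
  -- Step 2: the supremum equals `t` (local right-non-increase).
  rcases hct.eq_or_lt with h | h
  · rw [h] at hcS
    exact hcS
  · exfalso
    obtain ⟨h₀, hh₀, hh⟩ := hdini (sSup S)
    have hpos : 0 < min h₀ (t - sSup S) := lt_min hh₀ (tsub_pos_of_lt h)
    have hstep := hh (min h₀ (t - sSup S)) hpos (min_le_left _ _)
    have hmem : sSup S + min h₀ (t - sSup S) ∈ S := by
      refine ⟨hsc.trans le_self_add, ?_, ?_⟩
      · calc sSup S + min h₀ (t - sSup S) ≤ sSup S + (t - sSup S) :=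
              add_le_add_right (min_le_right _ _) _
          _ = t := add_tsub_cancel_of_le hct
      · have : f (sSup S + min h₀ (t - sSup S)) - ε * ((sSup S + min h₀ (t - sSup S) : ℝ≥0) : ℝ)
            ≤ f (sSup S) - ε * (sSup S : ℝ≥0) := by
          rw [NNReal.coe_add]
          linarith
        exact this.trans hcS
    exact absurd (le_csSup hbdd hmem) (not_le.2 (lt_add_of_pos_right _ hpos))

/-- **Dini glue, real form.** A function `f : ℝ≥0 → ℝ` which is lower semicontinuous
(neighbourhood form) and satisfies `∀ t, ∀ ε > 0, ∃ h₀ > 0, ∀ 0 < h ≤ h₀, f (t + h) ≤ f t + ε h`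
(non-positive upper-right Dini derivative) is antitone: apply `sub_mul_le_sub_mul` for every
slope `ε > 0` and let `ε → 0`. [folklore] -/
theorem antitone_real {f : ℝ≥0 → ℝ}
    (hlsc : ∀ (t₀ : ℝ≥0) (m : ℝ), m < f t₀ →
      ∃ ρ : ℝ≥0, 0 < ρ ∧ ∀ t : ℝ≥0, t₀ ≤ t + ρ → t ≤ t₀ + ρ → m < f t)
    (hdini : ∀ (t : ℝ≥0) (ε : ℝ≥0), 0 < ε →
      ∃ h₀ : ℝ≥0, 0 < h₀ ∧ ∀ h : ℝ≥0, 0 < h → h ≤ h₀ → f (t + h) ≤ f t + ε * h)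
    {s t : ℝ≥0} (hst : s ≤ t) : f t ≤ f s := by
  refine le_of_forall_pos_le_add fun δ hδ => ?_
  obtain ⟨e, he, hlt⟩ := exists_pos_mul_lt hδ ((t : ℝ) - s)
  have key := sub_mul_le_sub_mul hlsc (ε := Real.toNNReal e)
    (fun u => hdini u _ (Real.toNNReal_pos.2 he)) hst
  rw [Real.coe_toNNReal _ he.le] at key
  nlinarith [key, hlt]

/-- Lower semicontinuity (neighbourhood form) passes from a pointwise-finite `g : ℝ≥0 → ℝ≥0∞` to
`ENNReal.toReal ∘ g` (negative levels are trivial, non-negative ones go through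
`ENNReal.ofReal`). [folklore] -/
theorem lsc_toReal {g : ℝ≥0 → ℝ≥0∞} (hfin : ∀ t : ℝ≥0, g t ≠ ⊤)
    (hlsc : ∀ (t₀ : ℝ≥0) (m : ℝ≥0∞), m < g t₀ →
      ∃ ρ : ℝ≥0, 0 < ρ ∧ ∀ t : ℝ≥0, t₀ ≤ t + ρ → t ≤ t₀ + ρ → m < g t)
    (t₀ : ℝ≥0) (m : ℝ) (hm : m < (g t₀).toReal) :
    ∃ ρ : ℝ≥0, 0 < ρ ∧ ∀ t : ℝ≥0, t₀ ≤ t + ρ → t ≤ t₀ + ρ → m < (g t).toReal := by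
  rcases lt_or_ge m 0 with hm0 | hm0
  · exact ⟨1, one_pos, fun t _ _ => hm0.trans_le ENNReal.toReal_nonneg⟩
  · obtain ⟨ρ, hρ, h⟩ :=
      hlsc t₀ (ENNReal.ofReal m) ((ENNReal.ofReal_lt_iff_lt_toReal hm0 (hfin t₀)).2 hm)
    exact ⟨ρ, hρ, fun t h1 h2 => (ENNReal.ofReal_lt_iff_lt_toReal hm0 (hfin t)).1 (h t h1 h2)⟩

/-- A one-step Dini bound `g (t + h) ≤ g t + ε h` in `ℝ≥0∞` passes to `ENNReal.toReal ∘ g` when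
`g` is pointwise finite. [folklore] -/
theorem dini_toReal {g : ℝ≥0 → ℝ≥0∞} (hfin : ∀ t : ℝ≥0, g t ≠ ⊤) {t h ε : ℝ≥0}
    (H : g (t + h) ≤ g t + ((ε * h : ℝ≥0) : ℝ≥0∞)) :
    (g (t + h)).toReal ≤ (g t).toReal + ε * h := by
  have := ENNReal.toReal_mono (ENNReal.add_ne_top.2 ⟨hfin t, ENNReal.coe_ne_top⟩) H
  rwa [ENNReal.toReal_add (hfin t) ENNReal.coe_ne_top, ENNReal.coe_toReal, NNReal.coe_mul] at this

end DiniGlue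

/-- **DiniGlue (real analysis).** A pointwise-finite function `g : ℝ≥0 → ℝ≥0∞` that is lower
semicontinuous (neighbourhood form) and whose upper-right Dini derivative is non-positive everywhere
(`∀ t, ∀ ε > 0, ∃ h₀ > 0, ∀ 0 < h ≤ h₀, g (t+h) ≤ g t + ε h`) is antitone. Proof: for `ε > 0` the
function `g - ε·id` (in `ℝ`, via `ENNReal.toReal`) is lsc and locally right-non-increasing, hence
antitone by the supremum argument on `{u ∈ [s,t] : (g - ε id) u ≤ (g - ε id) s}`; let `ε → 0`.
[folklore] -/
theorem stub_diniGlue :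
    ∀ g : NNReal → ENNReal, (∀ t : NNReal, g t ≠ ⊤) →
      (∀ (t₀ : NNReal) (m : ENNReal), m < g t₀ →
        ∃ ρ : NNReal, 0 < ρ ∧ ∀ t : NNReal, t₀ ≤ t + ρ → t ≤ t₀ + ρ → m < g t) →
      (∀ (t : NNReal) (ε : NNReal), 0 < ε →
        ∃ h₀ : NNReal, 0 < h₀ ∧ ∀ h : NNReal, 0 < h → h ≤ h₀ → g (t + h) ≤ g t + ((ε * h : NNReal) : ENNReal)) →
      ∀ s t : NNReal, s ≤ t → g t ≤ g s := by
  intro g hfin hlsc hdini s t hst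
  refine (ENNReal.toReal_le_toReal (hfin t) (hfin s)).1 ?_
  refine DiniGlue.antitone_real (f := fun u => (g u).toReal) (DiniGlue.lsc_toReal hfin hlsc)
    (fun u ε hε => ?_) hst
  obtain ⟨h₀, hh₀, H⟩ := hdini u ε hε
  exact ⟨h₀, hh₀, fun h hh hle => DiniGlue.dini_toReal hfin (H h hh hle)⟩

end Summit.AtomisticToContinuum.BoseEinsteinCondensation.Cruxes.HardCoreDominates.Birth

end
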